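import Mathlib
import HarnessLib
import Summits.RiemannHypothesis.RiemannHypothesis.Theorems.IntegerScrewRungCertWideCheck
import Summits.RiemannHypothesis.RiemannHypothesis.Theorems.IntegerScrewRungCertLerchN

/-!
# Route `IntegerScrew` — kernel certificate checker for the finite rungs: the STREAMED entry table `uTableNA`

The entry table `utab[a][b] ∋ u(a,b) = Ψ(log(a/b)) − ζ(2,¼)/4` of the wide rung checker (`uTableW` of
`IntegerScrewRungCertWide`) costs `≈ 47 ms` of kernel time per entry at `N = 127` (`≈ 380 s` for the 8 128 entries of
`S_128`, 18 `decide +kernel` chunks of `IntegerScrewRung128`): indexed walks into the logarithm / square-root tables,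
a prime sum re-summed term by term for every entry (`≈ (a/b)` table walks each), the Hurwitz–Lerch series in interval
records, Moore products.  This file keeps the mathematics and the enclosure SHAPE of `uEnclW` and changes only the
program the kernel runs:

* `mulP` / `divP` (+ `mem_mulP` / `mem_divP`) — products / quotients of NONNEGATIVE quantities in direct `ℕ` arithmetic;
* `prefixTab` / `mem_prefixTab` — the prime sum through PREFIX SUMS built once per chunk,
  `Σ_{n≤m} Λ(n)n^{-1/2}(t − log n) = t·P(m) − Q(m)` (`primeSum_eq_prefix`), read at `m = ⌊a/b⌋`;
* `uEntryN` / `uRowGo` / `uRowN` / **`uTableNA lam sqs logs A N TB`** — row `a` STREAMED over the table cursors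
  (`log b`, `√b`, term counts `kAuto TB a b` by formula — no `ktab` data), the Hurwitz–Lerch piece by the direct-`ℕ`
  loop `lerchEnclN` (`…LerchN`); `ug_uTableNA`, ★ `mem_ug_uTableNA : u(a,b) ∈ ug (uTableNA …) a b` (`0 < b < a ≤ N + 1`);
* the ASSEMBLY (`posDef_of_rungW_mem`, `posDef_of_rungNA`, `quadForm_ge_of_rungW_mem`) is in `IntegerScrewRungCertTableNSound`.

Measured on the gate farm (this seat, 2026-08-25, tree data of `S_128` / `S_64`): rows `100 … 128` of the table in
`≈ 27 s` of kernel time (gen7: nine chunks, `≈ 180 s`), i.e. `≈ 8 ms` per entry, `≈ 6×`; and END TO END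
`zcheckRowsK 63 (uTableN… 63 …) lz63 lamZ63 2^88 2^40 0 63 = true` — the whole `S_64` table AND its packed domination
test (`IntegerScrewRungCertKron`) in ONE `decide +kernel` of `≈ 18 s` (gen5's `S_64` rung: five decides, `≈ 100 s`); at
`N = 255` the last row test `zcheckRowsK 255 (uTableNA … 255 21) lz255 lamZ255 2^70 2^31 254 1 = true` in `≈ 22 s`
(engine A's factor `lz255`, exact offline re-run of all 255 rows passed; HOME/rh-explicit-sos-eng-1/code/s256/).  Nothing here bears on the truth of RH (every rung is an RH-consequence
made unconditional by computation).  References: S. M. Rump, Acta Numerica 19 (2010) §10.8 [folklore]; M. Suzuki,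
J. Lond. Math. Soc. (2) 108 (2023), (1.1), (1.4) [Suzuki2023].
-/

set_option linter.dupNamespace false
set_option autoImplicit false

namespace Summit.RiemannHypothesis.RiemannHypothesis.Theorems.IntegerScrew.RungCert

open Literature.NumberTheory.LFunctions Literature.Analysis.ValidatedNumerics Finset
open Literature.Analysis.ValidatedNumerics.Numerics
open scoped BigOperators

/-! ## Products and quotients of NONNEGATIVE quantities in direct `ℕ` arithmetic

An interval operation of the tree's `FI` engine costs ≈ 0.3–0.8 ms of kernel time (`Int` records through notation); the same bounds
computed with `Nat.mul / Nat.div / Nat.add` on the `Int.toNat` of the endpoints cost ≈ 10×less (HOME/KERNEL-COST-MODEL.md).  Sound for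
NONNEGATIVE members only — every factor of `u(a,b)`'s pieces is nonnegative (`√a`, `log a − log b`, `Λ`-sums, the slope, `Φ`). -/

/-- `⌊p·q/2^48⌋ … ⌈P·Q/2^48⌉` on the clipped endpoints (`Int.toNat`), direct `ℕ` primitives. [folklore] -/
def mulP (I J : FI) : FI :=
  ⟨Int.ofNat (Nat.div (Nat.mul I.lo.toNat J.lo.toNat) SC),
   Int.ofNat (Nat.div (Nat.add (Nat.mul I.hi.toNat J.hi.toNat) (SC - 1)) SC)⟩

/-- `⌊p/n⌋ … ⌈P/n⌉` on the clipped endpoints, direct `ℕ` primitives. [folklore] -/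
def divP (I : FI) (n : ℕ) : FI :=
  ⟨Int.ofNat (Nat.div I.lo.toNat n), Int.ofNat (Nat.div (Nat.add I.hi.toNat (n - 1)) n)⟩

/-- The clipped lower endpoint is below `x·2^48` for a nonnegative member. [folklore] -/
theorem toNat_lo_le {x : ℝ} {I : FI} (hx : FI.mem x I) (hx0 : 0 ≤ x) : ((I.lo.toNat : ℕ) : ℝ) ≤ x * SC := by
  rcases le_or_gt 0 I.lo with h | h
  · have e : ((I.lo.toNat : ℕ) : ℤ) = I.lo := Int.toNat_of_nonneg h
    have : ((I.lo.toNat : ℕ) : ℝ) = (I.lo : ℝ) := by exact_mod_cast e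
    rw [this]; exact hx.1
  · rw [Int.toNat_eq_zero.mpr h.le]; simp; positivity

/-- The clipped upper endpoint is above `x·2^48`. [folklore] -/
theorem le_toNat_hi {x : ℝ} {I : FI} (hx : FI.mem x I) : x * SC ≤ ((I.hi.toNat : ℕ) : ℝ) := by
  have h1 : (I.hi : ℝ) ≤ ((I.hi.toNat : ℕ) : ℝ) := by exact_mod_cast Int.self_le_toNat I.hi
  exact hx.2.trans h1

/-- Ceiling division in `ℕ`, read in `ℝ`: `m/n ≤ ⌈m/n⌉ = (m + n − 1)/n`. [folklore] -/
theorem div_le_natCeilDiv (m : ℕ) {n : ℕ} (hn : 0 < n) : (m : ℝ) / n ≤ (((m + (n - 1)) / n : ℕ) : ℝ) := by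
  rw [div_le_iff₀ (by exact_mod_cast hn)]
  have h : m ≤ (m + (n - 1)) / n * n := by
    have := Nat.div_add_mod (m + (n - 1)) n
    have h2 : (m + (n - 1)) % n < n := Nat.mod_lt _ hn
    rw [mul_comm]; omega
  exact_mod_cast h

/-- **`mulP` encloses the product of nonnegative members.** [folklore] -/
theorem mem_mulP {x y : ℝ} {I J : FI} (hx : FI.mem x I) (hy : FI.mem y J) (hx0 : 0 ≤ x) (hy0 : 0 ≤ y) :
    FI.mem (x * y) (mulP I J) := by
  have hSC := SC_pos
  have hp := toNat_lo_le hx hx0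
  have hq := toNat_lo_le hy hy0
  have hP := le_toNat_hi hx
  have hQ := le_toNat_hi hy
  have hxS : 0 ≤ x * SC := by positivity
  have hyS : 0 ≤ y * SC := by positivity
  refine ⟨?_, ?_⟩
  · show ((Int.ofNat (I.lo.toNat * J.lo.toNat / SC) : ℤ) : ℝ) ≤ x * y * SC
    rw [Int.ofNat_eq_natCast, Int.cast_natCast]
    have h1 : (((I.lo.toNat * J.lo.toNat / SC : ℕ)) : ℝ) * SC ≤ ((I.lo.toNat * J.lo.toNat : ℕ) : ℝ) := by
      exact_mod_cast Nat.div_mul_le_self _ _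
    have h2 : ((I.lo.toNat * J.lo.toNat : ℕ) : ℝ) ≤ x * SC * (y * SC) := by
      push_cast; exact mul_le_mul hp hq (by positivity) hxS
    nlinarith
  · show x * y * SC ≤ ((Int.ofNat ((I.hi.toNat * J.hi.toNat + (SC - 1)) / SC) : ℤ) : ℝ)
    rw [Int.ofNat_eq_natCast, Int.cast_natCast]
    have h1 := div_le_natCeilDiv (I.hi.toNat * J.hi.toNat) (n := SC) (by exact_mod_cast hSC)
    have h2 : x * SC * (y * SC) ≤ ((I.hi.toNat * J.hi.toNat : ℕ) : ℝ) := by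
      push_cast; exact mul_le_mul hP hQ hyS (hxS.trans hP)
    have h3 : x * y * SC ≤ ((I.hi.toNat * J.hi.toNat : ℕ) : ℝ) / SC := by
      rw [le_div_iff₀ hSC]; nlinarith
    exact h3.trans h1

/-- **`divP` encloses the quotient of a nonnegative member by `n > 0`.** [folklore] -/
theorem mem_divP {x : ℝ} {I : FI} (hx : FI.mem x I) (hx0 : 0 ≤ x) {n : ℕ} (hn : 0 < n) :
    FI.mem (x / n) (divP I n) := by
  have hn' : (0 : ℝ) < n := by exact_mod_cast hn
  have hp := toNat_lo_le hx hx0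
  have hP := le_toNat_hi hx
  refine ⟨?_, ?_⟩
  · show ((Int.ofNat (I.lo.toNat / n) : ℤ) : ℝ) ≤ x / n * SC
    rw [Int.ofNat_eq_natCast, Int.cast_natCast]
    have h1 : (((I.lo.toNat / n : ℕ)) : ℝ) ≤ ((I.lo.toNat : ℕ) : ℝ) / n := Nat.cast_div_le
    have : ((I.lo.toNat : ℕ) : ℝ) / n ≤ x / n * SC := by
      rw [div_mul_eq_mul_div, div_le_div_iff_of_pos_right hn']; exact hp
    exact h1.trans this
  · show x / n * SC ≤ ((Int.ofNat ((I.hi.toNat + (n - 1)) / n) : ℤ) : ℝ)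
    rw [Int.ofNat_eq_natCast, Int.cast_natCast]
    have h1 := div_le_natCeilDiv I.hi.toNat hn
    have : x / n * SC ≤ ((I.hi.toNat : ℕ) : ℝ) / n := by
      rw [div_mul_eq_mul_div, div_le_div_iff_of_pos_right hn']; exact hP
    exact this.trans h1

/-! ## Prefix sums for the prime sum: `Σ_{n≤m} Λ(n)n^{-1/2}(t − log n) = t·P(m) − Q(m)` -/

/-- The summand `Λ(n) n^{-1/2}` enclosed (exact zero when `Λ(n) = 0`). [folklore] -/
def lamTermP (L : List (ℕ × ℕ × ℕ)) (sqs logs : List FI) (n : ℕ) : FI :=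
  if lamG L n = 1 then ⟨0, 0⟩ else mulP (lg logs (lamG L n)) (divP (lg sqs n) n)

/-- One pass emitting the running sums `(P(n), Q(n))`, `P(n) = Σ_{m≤n} Λ(m)m^{-1/2}`,
`Q(n) = Σ_{m≤n} Λ(m)m^{-1/2} log m`, for `n, n+1, …` (`c` entries). [folklore] -/
def prefixGo (L : List (ℕ × ℕ × ℕ)) (sqs logs : List FI) : ℕ → ℕ → FI → FI → List (FI × FI)
  | 0, _, _, _ => []
  | c + 1, n, P, Q =>
      (P, Q) :: prefixGo L sqs logs c (n + 1) (P.add (lamTermP L sqs logs (n + 1)))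
        (Q.add (mulP (lamTermP L sqs logs (n + 1)) (lg logs (n + 1))))

/-- The prefix tables, entry `m` at index `m`, `m = 0 … K`. [folklore] -/
def prefixTab (L : List (ℕ × ℕ × ℕ)) (sqs logs : List FI) (K : ℕ) : List (FI × FI) :=
  prefixGo L sqs logs (K + 1) 0 ⟨0, 0⟩ ⟨0, 0⟩

/-- `P(m)` over `ℝ`. [folklore] -/
noncomputable def PsumR (m : ℕ) : ℝ := ∑ n ∈ Finset.Icc 1 m, (ArithmeticFunction.vonMangoldt n : ℝ) / Real.sqrt n

/-- `Q(m)` over `ℝ`. [folklore] -/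
noncomputable def QsumR (m : ℕ) : ℝ :=
  ∑ n ∈ Finset.Icc 1 m, (ArithmeticFunction.vonMangoldt n : ℝ) / Real.sqrt n * Real.log n

/-- The prime sum of `u(a,b)` through the prefix sums. [folklore] -/
theorem primeSum_eq_prefix (t : ℝ) (m : ℕ) :
    ∑ n ∈ Finset.Icc 1 m, (ArithmeticFunction.vonMangoldt n : ℝ) / Real.sqrt n * (t - Real.log n) =
      t * PsumR m - QsumR m := by
  rw [PsumR, QsumR, Finset.mul_sum, ← Finset.sum_sub_distrib]
  exact Finset.sum_congr rfl fun n _ => by ring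

/-- One summand is enclosed (`1 ≤ n ≤ K`). [folklore] -/
theorem mem_lamTermP {L : List (ℕ × ℕ × ℕ)} {sqs logs : List FI} {K : ℕ}
    (hΛ : ∀ n ≤ K, (ArithmeticFunction.vonMangoldt n : ℝ) = Real.log (lamG L n) ∧ lamG L n ≤ max n 1)
    (hS : ∀ n ≤ K, FI.mem (Real.sqrt n) (lg sqs n)) (hL : ∀ n ≤ K, FI.mem (Real.log n) (lg logs n))
    {n : ℕ} (hn1 : 1 ≤ n) (hn : n ≤ K) :
    FI.mem ((ArithmeticFunction.vonMangoldt n : ℝ) / Real.sqrt n) (lamTermP L sqs logs n) := by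
  obtain ⟨hv, hle⟩ := hΛ n hn
  unfold lamTermP
  split_ifs with h1
  · rw [hv, h1, Nat.cast_one, Real.log_one, zero_div]; exact ⟨by simp, by simp⟩
  · have hlam : lamG L n ≤ K := hle.trans (max_le hn (hn1.trans hn))
    have hlog0 : 0 ≤ Real.log (lamG L n) := Real.log_natCast_nonneg _
    have h := mem_mulP (hL _ hlam) (mem_divP (hS n hn) (Real.sqrt_nonneg _) hn1) hlog0
      (div_nonneg (Real.sqrt_nonneg _) (Nat.cast_nonneg _))
    rw [hv]
    have e : Real.log (lamG L n) / Real.sqrt n = Real.log (lamG L n) * (Real.sqrt n / n) := by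
      rw [Real.sqrt_div_self']; ring
    rw [e]; exact h

/-- Length of the one-pass table. [folklore] -/
theorem length_prefixGo (L : List (ℕ × ℕ × ℕ)) (sqs logs : List FI) :
    ∀ (c n : ℕ) (P Q : FI), (prefixGo L sqs logs c n P Q).length = c
  | 0, _, _, _ => rfl
  | c + 1, n, P, Q => by simp [prefixGo, length_prefixGo L sqs logs c]

/-- Entries of the one-pass table enclose the running sums. [folklore] -/
theorem prefixGo_getD {L : List (ℕ × ℕ × ℕ)} {sqs logs : List FI} {K : ℕ}
    (hΛ : ∀ n ≤ K, (ArithmeticFunction.vonMangoldt n : ℝ) = Real.log (lamG L n) ∧ lamG L n ≤ max n 1)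
    (hS : ∀ n ≤ K, FI.mem (Real.sqrt n) (lg sqs n)) (hL : ∀ n ≤ K, FI.mem (Real.log n) (lg logs n)) :
    ∀ (c n : ℕ) (P Q : FI), FI.mem (PsumR n) P → FI.mem (QsumR n) Q → ∀ t < c, n + t ≤ K →
      FI.mem (PsumR (n + t)) ((prefixGo L sqs logs c n P Q).getD t (⟨0, 0⟩, ⟨0, 0⟩)).1 ∧
        FI.mem (QsumR (n + t)) ((prefixGo L sqs logs c n P Q).getD t (⟨0, 0⟩, ⟨0, 0⟩)).2
  | 0, _, _, _, _, _, t, ht, _ => by omega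
  | c + 1, n, P, Q, hP, hQ, 0, _, _ => by simpa [prefixGo] using ⟨hP, hQ⟩
  | c + 1, n, P, Q, hP, hQ, t + 1, ht, hK => by
      have hn1 : n + 1 ≤ K := by omega
      have htm := mem_lamTermP hΛ hS hL (n := n + 1) (by omega) hn1
      have hP' : FI.mem (PsumR (n + 1)) (P.add (lamTermP L sqs logs (n + 1))) := by
        rw [PsumR, Finset.sum_Icc_succ_top (by omega), ← PsumR]; exact FI.mem_add hP htm
      have hQ' : FI.mem (QsumR (n + 1)) (Q.add (mulP (lamTermP L sqs logs (n + 1)) (lg logs (n + 1)))) := by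
        rw [QsumR, Finset.sum_Icc_succ_top (by omega), ← QsumR]
        refine FI.mem_add hQ ?_
        have h0 : 0 ≤ (ArithmeticFunction.vonMangoldt (n + 1) : ℝ) / Real.sqrt (n + 1 : ℕ) :=
          div_nonneg ArithmeticFunction.vonMangoldt_nonneg (Real.sqrt_nonneg _)
        have := mem_mulP htm (hL _ hn1) h0 (Real.log_natCast_nonneg _)
        push_cast at this ⊢
        exact this
      have ih := prefixGo_getD hΛ hS hL c (n + 1) _ _ hP' hQ' t (by omega) (by omega)
      simp only [prefixGo, List.getD_cons_succ]
      have e : n + (t + 1) = n + 1 + t := by omega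
      rw [e]; exact ih

/-- **The prefix tables enclose `P(m)` and `Q(m)`** (`m ≤ K`). [folklore] -/
theorem mem_prefixTab {L : List (ℕ × ℕ × ℕ)} {sqs logs : List FI} {K : ℕ}
    (hΛ : ∀ n ≤ K, (ArithmeticFunction.vonMangoldt n : ℝ) = Real.log (lamG L n) ∧ lamG L n ≤ max n 1)
    (hS : ∀ n ≤ K, FI.mem (Real.sqrt n) (lg sqs n)) (hL : ∀ n ≤ K, FI.mem (Real.log n) (lg logs n))
    {m : ℕ} (hm : m ≤ K) :
    FI.mem (PsumR m) ((prefixTab L sqs logs K).getD m (⟨0, 0⟩, ⟨0, 0⟩)).1 ∧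
      FI.mem (QsumR m) ((prefixTab L sqs logs K).getD m (⟨0, 0⟩, ⟨0, 0⟩)).2 := by
  have h0P : FI.mem (PsumR 0) (⟨0, 0⟩ : FI) := by simp [PsumR, FI.mem]
  have h0Q : FI.mem (QsumR 0) (⟨0, 0⟩ : FI) := by simp [QsumR, FI.mem]
  have := prefixGo_getD hΛ hS hL (K + 1) 0 _ _ h0P h0Q m (by omega) (by omega)
  simpa [prefixTab] using this

/-- The slope `A = γ + π/2 + 3 log 2 + log π` is positive. [folklore] -/
theorem slopeA_pos : 0 < slopeA := by
  unfold slopeA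
  have h1 : 0 < Real.eulerMascheroniConstant := lt_trans (by norm_num) Real.one_half_lt_eulerMascheroniConstant
  have h2 : 0 < Real.log 2 := Real.log_pos (by norm_num)
  have h3 : 0 < Real.log Real.pi := Real.log_pos (by linarith [Real.pi_gt_three])
  positivity

/-! ## The streamed entry / row / table -/

/-- `u(a,b)` enclosed from the per-entry data: slope `A`, `la ∋ log a`, `sa ∋ √a`, `lb ∋ log b`, `sb ∋ √b`,
`PQ ∋ (P(⌊a/b⌋), Q(⌊a/b⌋))`, `K` Hurwitz–Lerch terms (direct-`ℕ` loop). [folklore] -/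
def uEntryN (A la sa lb sb : FI) (PQ : FI × FI) (a b K : ℕ) : FI :=
  let T := la.sub lb
  let g := mulP sa sb
  let s := divP g b
  let s' := divP g a
  let arch := ((s.add s').sub (FI.ofInt 2)).mulInt 4
  let P := (mulP T PQ.1).sub PQ.2
  let lin := divP (mulP T A) 2
  let ler := divP (mulP s' (lerchEnclN a b K)) 4
  ((arch.sub P).sub lin).sub ler

/-- Entries `b, b+1, …` (`c` of them) of row `a`, streaming over the logarithm / square-root / term-count
cursors (no indexed access except the short walk `PQs[⌊a/b⌋]`). [folklore] -/
def uRowGo (A la sa : FI) (PQs : List (FI × FI)) (a : ℕ) : ℕ → ℕ → List FI → List FI → List ℕ → List FI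
  | 0, _, _, _, _ => []
  | c + 1, b, lgs, sqz, kts =>
      uEntryN A la sa (lgs.headD (FI.ofInt 0)) (sqz.headD (FI.ofInt 0)) (PQs.getD (a / b) (⟨0, 0⟩, ⟨0, 0⟩)) a b
          (kts.headD 0) ::
        uRowGo A la sa PQs a c (b + 1) (lgs.drop 1) (sqz.drop 1) (kts.drop 1)

/-- Row `a` of the table: a junk entry at `b = 0`, then `u(a,b)`, `b = 1 … a−1`. [folklore] -/
def uRowN (sqs logs : List FI) (A : FI) (PQs : List (FI × FI)) (a : ℕ) (kts : List ℕ) : List FI :=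
  FI.ofInt 0 :: uRowGo A (lg logs a) (lg sqs a) PQs a (a - 1) 1 (logs.drop 1) (sqs.drop 1) (kts.drop 1)

/-- **`u(a,b) ∈ uEntryN …`** on enclosing data (`0 < b < a`). [folklore] -/
theorem mem_uEntryN {A la sa lb sb : FI} {PQ : FI × FI} {a b : ℕ} (hb : 0 < b) (hab : b < a)
    (hA : FI.mem slopeA A) (hla : FI.mem (Real.log a) la) (hsa : FI.mem (Real.sqrt a) sa)
    (hlb : FI.mem (Real.log b) lb) (hsb : FI.mem (Real.sqrt b) sb)
    (hP : FI.mem (PsumR (a / b)) PQ.1) (hQ : FI.mem (QsumR (a / b)) PQ.2) (K : ℕ) :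
    FI.mem (uR a b) (uEntryN A la sa lb sb PQ a b K) := by
  have ha : 0 < a := hb.trans hab
  rw [uR_eq hb hab, primeSum_eq_prefix]
  have ha' : (0 : ℝ) < a := by exact_mod_cast ha
  have hb' : (0 : ℝ) < b := by exact_mod_cast hb
  have hT0 : 0 ≤ Real.log a - Real.log b :=
    sub_nonneg.2 (Real.log_le_log hb' (by exact_mod_cast hab.le))
  have hg0 : 0 ≤ Real.sqrt a * Real.sqrt b := mul_nonneg (Real.sqrt_nonneg _) (Real.sqrt_nonneg _)
  have hP0 : 0 ≤ PsumR (a / b) := Finset.sum_nonneg fun n _ =>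
    div_nonneg ArithmeticFunction.vonMangoldt_nonneg (Real.sqrt_nonneg _)
  have hler0 : 0 ≤ ∑' k : ℕ, (((b * b : ℕ) : ℝ) / ((a * a : ℕ) : ℝ)) ^ k / ((k : ℝ) + 1 / 4) ^ 2 :=
    tsum_nonneg fun k => by positivity
  have hT : FI.mem (Real.log a - Real.log b) (la.sub lb) := FI.mem_sub hla hlb
  have hg : FI.mem (Real.sqrt a * Real.sqrt b) (mulP sa sb) := mem_mulP hsa hsb (Real.sqrt_nonneg _) (Real.sqrt_nonneg _)
  have hs : FI.mem (Real.sqrt a * Real.sqrt b / b) (divP (mulP sa sb) b) := mem_divP hg hg0 hb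
  have hs' : FI.mem (Real.sqrt a * Real.sqrt b / a) (divP (mulP sa sb) a) := mem_divP hg hg0 ha
  have h2 : FI.mem (2 : ℝ) (FI.ofInt 2) := by simpa using FI.mem_ofInt 2
  have harch : FI.mem (4 * (Real.sqrt a * Real.sqrt b / b + Real.sqrt a * Real.sqrt b / a - 2))
      ((((divP (mulP sa sb) b).add (divP (mulP sa sb) a)).sub (FI.ofInt 2)).mulInt 4) := by
    have := FI.mem_mulInt (FI.mem_sub (FI.mem_add hs hs') h2) 4
    push_cast at this
    rw [mul_comm] at this
    exact this
  have hPr : FI.mem ((Real.log a - Real.log b) * PsumR (a / b) - QsumR (a / b))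
      ((mulP (la.sub lb) PQ.1).sub PQ.2) := FI.mem_sub (mem_mulP hT hP hT0 hP0) hQ
  have hlin : FI.mem ((Real.log a - Real.log b) * slopeA / 2) (divP (mulP (la.sub lb) A) 2) :=
    mem_divP (mem_mulP hT hA hT0 slopeA_pos.le) (mul_nonneg hT0 slopeA_pos.le) (by norm_num)
  have hler := mem_divP (mem_mulP hs' (mem_lerchEnclN hab K) (div_nonneg hg0 ha'.le) hler0)
    (mul_nonneg (div_nonneg hg0 ha'.le) hler0) (n := 4) (by norm_num)
  have := FI.mem_sub (FI.mem_sub (FI.mem_sub harch hPr) hlin) hler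
  push_cast at this ⊢
  exact this

/-- Entries of the streamed row. [folklore] -/
theorem uRowGo_getElem (A la sa : FI) (PQs : List (FI × FI)) (a : ℕ) :
    ∀ (c b : ℕ) (lgs sqz : List FI) (kts : List ℕ) (t : ℕ), t < c →
      (uRowGo A la sa PQs a c b lgs sqz kts)[t]? =
        some (uEntryN A la sa (lgs.getD t (FI.ofInt 0)) (sqz.getD t (FI.ofInt 0))
          (PQs.getD (a / (b + t)) (⟨0, 0⟩, ⟨0, 0⟩)) a (b + t) (kts.getD t 0))
  | 0, b, lgs, sqz, kts, t, ht => by omega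
  | c + 1, b, lgs, sqz, kts, 0, _ => by
      simp [uRowGo, List.headD_eq_head?_getD, List.getD_eq_getElem?_getD, List.head?_eq_getElem?]
  | c + 1, b, lgs, sqz, kts, t + 1, ht => by
      rw [uRowGo, List.getElem?_cons_succ, uRowGo_getElem A la sa PQs a c (b + 1) _ _ _ t (by omega)]
      have e : b + 1 + t = b + (t + 1) := by omega
      simp only [List.getD_eq_getElem?_getD, List.getElem?_drop, Nat.add_comm 1 t, e]

/-! ## Term counts by formula (no `ktab` data): `uTableNA` -/

/-- `⌊log₂ y⌋ + 1` for `y > 0`, else `0`. [folklore] -/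
def bitLen (y : ℕ) : ℕ := if y = 0 then 0 else Nat.log2 y + 1

/-- One refinement step of the term-count formula: `K ≈ 0.35·a·log₂(y/(4K+1)²)/(a−b)`. [folklore] -/
def kStep (a d y K : ℕ) : ℕ := (a * bitLen (y / ((4 * K + 1) * (4 * K + 1))) * 7) / (20 * d) + 4

/-- **Number of Hurwitz–Lerch terms for the entry `(a,b)` at tail tolerance `2^-TB`**, from the geometric tail bound
`16x^K/((4K+1)²(1−x)) ≤ 2^-TB` solved approximately (three fixed-point steps; the enclosure is sound for ANY count,
`mem_lerchEnclN` — the formula only sizes the work: `≈ 1.35×` the minimal counts, never fewer, for `a ≤ 256`).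
[folklore] -/
def kAuto (TB a b : ℕ) : ℕ :=
  let d := a - b
  let y := (2 ^ (TB + 4) * a * a) / (a * a - b * b)
  kStep a d y (kStep a d y (kStep a d y 0))

/-- **The streamed table with term counts by formula** (tail tolerance `2^-TB`; no `ktab` literal). [folklore] -/
def uTableNA (L : List (ℕ × ℕ × ℕ)) (sqs logs : List FI) (A : FI) (N TB : ℕ) : List (List FI) :=
  (List.range (N + 2)).map fun a =>
    uRowN sqs logs A (prefixTab L sqs logs (N + 1)) a ((List.range a).map (kAuto TB a))

/-- Table lookup in `uTableNA` (`0 < b < a ≤ N + 1`). [folklore] -/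
theorem ug_uTableNA {L : List (ℕ × ℕ × ℕ)} {sqs logs : List FI} {A : FI} {N TB : ℕ} {a b : ℕ} (hb : 0 < b)
    (hba : b < a) (ha : a ≤ N + 1) :
    ug (uTableNA L sqs logs A N TB) a b =
      uEntryN A (lg logs a) (lg sqs a) (lg logs b) (lg sqs b)
        ((prefixTab L sqs logs (N + 1)).getD (a / b) (⟨0, 0⟩, ⟨0, 0⟩)) a b (kAuto TB a b) := by
  unfold ug uTableNA
  have h1 : ((List.range (N + 2)).map fun a =>
      uRowN sqs logs A (prefixTab L sqs logs (N + 1)) a ((List.range a).map (kAuto TB a))).getD a [] =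
      uRowN sqs logs A (prefixTab L sqs logs (N + 1)) a ((List.range a).map (kAuto TB a)) := by
    rw [List.getD_eq_getElem?_getD, List.getElem?_map, List.getElem?_range (by omega)]
    rfl
  rw [h1, uRowN]
  obtain ⟨t, rfl⟩ : ∃ t, b = t + 1 := ⟨b - 1, by omega⟩
  rw [List.getD_cons_succ, List.getD_eq_getElem?_getD,
    uRowGo_getElem A _ _ _ a (a - 1) 1 _ _ _ t (by omega), Option.getD_some]
  have e : 1 + t = t + 1 := by omega
  simp only [lg, List.getD_eq_getElem?_getD, List.getElem?_drop, e]
  rw [List.getElem?_map, List.getElem?_range hba]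
  rfl

/-- **`u(a,b) ∈ ug (uTableNA …) a b`** on validated tables (`0 < b < a ≤ N + 1 ≤ M`). [folklore] -/
theorem mem_ug_uTableNA {L : List (ℕ × ℕ × ℕ)} {sqs logs : List FI} {M N : ℕ}
    (hΛ : ∀ n ≤ M, (ArithmeticFunction.vonMangoldt n : ℝ) = Real.log (lamG L n) ∧ lamG L n ≤ max n 1)
    (hS : ∀ n ≤ M, FI.mem (Real.sqrt n) (lg sqs n)) (hL : ∀ n ≤ M, FI.mem (Real.log n) (lg logs n))
    (hNM : N + 1 ≤ M) {A : FI} (hA : FI.mem slopeA A) (TB : ℕ) {a b : ℕ} (hb : 0 < b) (hab : b < a)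
    (ha : a ≤ N + 1) : FI.mem (uR a b) (ug (uTableNA L sqs logs A N TB) a b) := by
  rw [ug_uTableNA hb hab ha]
  have hm : a / b ≤ N + 1 := (Nat.div_le_self a b).trans ha
  have hPQ := mem_prefixTab (K := N + 1) (fun n hn => hΛ n (hn.trans hNM)) (fun n hn => hS n (hn.trans hNM))
    (fun n hn => hL n (hn.trans hNM)) hm
  exact mem_uEntryN hb hab hA (hL a (ha.trans hNM)) (hS a (ha.trans hNM)) (hL b (by omega)) (hS b (by omega))
    hPQ.1 hPQ.2 _

end Summit.RiemannHypothesis.RiemannHypothesis.Theorems.IntegerScrew.RungCert
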